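import Summits.BirchSwinnertonDyer.BirchSwinnertonDyer.Theorems.EisensteinPrimesSurLambdaLimitVanishing
import Summits.BirchSwinnertonDyer.BirchSwinnertonDyer.Theorems.SchneiderFreeAdditiveX3PoitouTateSelmerComplementCanonical
import Literature.NumberTheory.IwasawaTheory.Greenberg2016.DualSelmerTorsionGlue
import Literature.NumberTheory.IwasawaTheory.Greenberg2016.CotorsionCokernelOfCorank
import Literature.NumberTheory.IwasawaTheory.Greenberg2006.CohomologyCofinitelyGeneratedGlobalLowDegree
import Literature.NumberTheory.IwasawaTheory.Greenberg2006.CohomologyCofinitelyGeneratedLocal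
import Literature.NumberTheory.GaloisRepresentations.ContinuousCohomologyFiniteGroupCofinite
import HarnessLib

/-!
# Road «SUR-Λ» (crux 2 `GoodLatticeBDPValue`, by-name input #9 `Greenberg2016.prop263_sur_of_crk`),
# brick (d)-1: Greenberg 2010 Prop. 3.2.1 (c) for totally complex `K`, ASSEMBLED modulo
# «`Ш¹(K, Σ, T*)` is `Λ`-torsion»

Cell `bsd-eis`, width seat `bsd-line-x1-p1-w4` (gen 18); helper for stmt-BirchSwinnertonDyer-19032
(`--supports`, `--as helper`), road memo `SUR-LAMBDA-ROAD-w5g9.md` §2/§7.4 C7.  THEOREMS ONLY (no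
definition, no named fact, no `sorry`; one private finiteness lemma).

PRINT (R. Greenberg, *Surjectivity of the global-to-local map defining a Selmer group*, Kyoto J. Math.
50 (2010), proof of Prop. 3.2.1, p. 15 L19–32): "`Ш¹(K, Σ, T*)` … is `Λ`-torsion [by LEO(𝐃) and the
duality between `Ш¹(K, Σ, T*)` and `Ш²(K, Σ, 𝐃)`] … By proposition 3.1.1, and the assumption about the
cokernel of `φ_𝓛`, it follows that `S_{𝓛*}(K, T*)` is a torsion `Λ`-module. … if assumption (c) is
satisfied, then proposition 2.3.2 implies that `S_{𝓛*}(K, T*)` vanishes. In all three cases,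
proposition 3.1.1 implies that `coker(φ_𝓛) = 0`."

WHAT THIS FILE PROVES.  For `Λ ≅ ℤ_p⟦T₁,…,T_m⟧`, a cofinitely generated, `Λ`-divisible discrete `𝐃`
with continuous `Λ`-linear `Gal(K_Σ/K)`-action (`K` TOTALLY COMPLEX, `Σ ⊇ {v ∣ p} ∪ ∞` finite), a
specification `𝓛` with CRK(𝐃, 𝓛) and hypothesis (c) at some `η ∈ Σ` (LOC_η⁽¹⁾(𝐃) and `Q_𝓛(K_η, 𝐃)`
divisible): **SUR(𝐃, 𝓛) holds as soon as `Ш¹(K, Σ, T*) = dualSha ρ e hD (canonical)` is `Λ`-torsion**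
(`sur_of_crk_caseC_tc_of_dualSha_torsion`) — every other input of the tree's skeleton
`Specification.sur_of_dualSelmer_inputs` is discharged BY NAME: `hC5` = `S_{𝓛*}/Ш¹*` torsion
(`exists_ne_zero_scalar_mem_dualSha_of_mem_dualSelmer`, fed with cotorsion of `coker φ_𝓛` from CRK by
`Specification.isCotorsion_coker_phi_of_crk` and cofinite generation of `H¹(K_Σ/K, 𝐃)` / `Q_𝓛(K, 𝐃)`),
`hC6` = «`S_{𝓛*} = 0 ⟹ SUR`» (`SurLambda.sur_of_dualSelmer_eq_zero`), and the four facts about THE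
canonical local invariant maps (`invLevelLaw_canonical`, `canonical_isPerfect`,
`sumLocalTermEqZero_canonical`, `unramifiedOrthogonal_of_isPerfect_allLevels`).  The closed corollary
`prop263_sur_of_crk_caseC_tc_of_dualSha_torsion` is the road's END STATEMENT
`Greenberg2016.prop263_sur_of_crk_caseC_tc` modulo the single remaining input, Greenberg's step (γ)
«`Ш¹(K, Σ, T*)` is `Λ`-torsion under LEO(𝐃)» (to be supplied by `ShaOneDualTorsionOfShaDuality` + the
restricted Poitou–Tate `Ш`-duality, Milne ADT I Thm. 4.10 (a)).

HONESTY: no summit statement, crux or stub is proved here; (γ) is a hypothesis.  AI formalisation,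
weaker than expert review; the statements are established only by the kernel check.

## References
* R. Greenberg, *Surjectivity of the global-to-local map defining a Selmer group*, Kyoto J. Math. 50
  (2010) 853–888, Prop. 3.1.1 (p. 14), Prop. 3.2.1 (c) and its proof (p. 15). [Greenberg2010]
* R. Greenberg, *On the structure of Selmer groups*, Springer PROMS 188 (2016), Prop. 2.6.3 (c)
  (§2.6 p. 10). [Greenberg2016Selmer]
* J. S. Milne, *Arithmetic Duality Theorems*, 2nd ed. (2006), Ch. I, Thm. 2.6, Thm. 4.10. [MilneADT2006]
-/

set_option linter.dupNamespace false

noncomputable section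

open scoped Classical
open CategoryTheory Function NumberField IsDedekindDomain Field IsLocalRing
open _root_.ContinuousCohomology

namespace Summit.BirchSwinnertonDyer.BirchSwinnertonDyer.Theorems.SurLambda

open Literature.NumberTheory.GaloisRepresentations Literature.NumberTheory.GaloisCohomology
open Literature.NumberTheory.GaloisRepresentations.DiscreteGaloisModule.TorsionLayers
open Literature.NumberTheory.IwasawaTheory.Greenberg2016
open Literature.NumberTheory.IwasawaTheory.Greenberg2006
open Summit.BirchSwinnertonDyer.BirchSwinnertonDyer.Theorems.SchneiderFreeAdditiveX3.PoitouTateReduction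
  (unramifiedOrthogonal_of_isPerfect_allLevels sumLocalTermEqZero_canonical)

variable {K : Type} [Field K] [NumberField K] {S : Set (HeightOneSpectrum (𝓞 K))}
  {Λ : Type} [CommRing Λ] [IsLocalRing Λ] [TopologicalSpace Λ] [IsTopologicalRing Λ]
  {D : Type} [AddCommGroup D] [Module Λ D] [TopologicalSpace D] [DiscreteTopology D]
  [ContinuousSMul Λ D]
  (ρ : ContinuousRep (GaloisGroupUnramifiedOutside K S) Λ D)
  {p : ℕ} [Fact p.Prime] {m : ℕ}

omit [IsLocalRing Λ] [IsTopologicalRing Λ] [DiscreteTopology D] [ContinuousSMul Λ D] [Fact p.Prime] in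
/-- `Σ` (the archimedean places and the places of `S`) is finite when `S` is.
[cite: Greenberg2016Selmer, §1 p. 3 L2–4] -/
private theorem finite_sigmaPlace' (hS : S.Finite) : Finite (SigmaPlace S) := by
  haveI : Finite S := hS
  let f : SigmaPlace S → InfinitePlace K ⊕ S := fun v ↦ match v with
    | ⟨Sum.inl w, _⟩ => Sum.inl w
    | ⟨Sum.inr v, hv⟩ => Sum.inr ⟨v, (inSigma_inr_iff S v).mp hv⟩
  refine Finite.of_injective f ?_
  rintro ⟨w | v, hv⟩ ⟨w' | v', hv'⟩ h
  · simp only [f, Sum.inl.injEq] at h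
    subst h; rfl
  · simp [f] at h
  · simp [f] at h
  · simp only [f, Sum.inr.injEq, Subtype.mk.injEq] at h
    subst h; rfl

omit [IsLocalRing Λ] in
/-- **`Q_𝓛(K, 𝐃) = ∏_{v ∈ Σ} H¹(K_v, 𝐃)/L(K_v, 𝐃)` is cofinitely generated** (`Σ` finite; each
`H¹(K_v, 𝐃)` is cofinitely generated, Greenberg 2006 Prop. 3.2 local, the tree's
`isCofinitelyGenerated_localRep_H`). [cite: Greenberg2006, Prop. 3.2 (p. 358), §4 p. 367 L33–39] -/
theorem isCofinitelyGenerated_QGlobal (hS : S.Finite) (e : Λ ≃+* MvPowerSeries (Fin m) ℤ_[p])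
    (hD : IsCofinitelyGenerated Λ D) (L : Specification S ρ) : IsCofinitelyGenerated Λ L.QGlobal := by
  haveI := finite_sigmaPlace' (K := K) hS
  haveI : IsNoetherianRing Λ := isNoetherianRing_of_ringEquiv_mvPowerSeries e
  exact isCofinitelyGenerated_pi (T := fun v : SigmaPlace S => L.Q v.1)
    fun v => (isCofinitelyGenerated_localRep_H S ρ e hD v.1 1).quotient (L v.1)

/-- **Greenberg 2010 Prop. 3.2.1 (c), `K` totally complex, modulo (γ)**: for `Λ ≅ ℤ_p⟦T₁,…,T_m⟧`, a
cofinitely generated `Λ`-divisible `𝐃`, `Σ ⊇ {v ∣ p} ∪ ∞` finite, a specification `𝓛` with CRK(𝐃, 𝓛)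
and (c) "`η ∈ Σ` non-archimedean with LOC_η⁽¹⁾(𝐃) and `Q_𝓛(K_η, 𝐃)` divisible" — IF `Ш¹(K, Σ, T*)`
(canonical local invariant maps) is `Λ`-torsion, THEN `φ_𝓛` is surjective.  Assembly of the tree's
`Specification.sur_of_dualSelmer_inputs` with `hC5 := exists_ne_zero_scalar_mem_dualSha_of_mem_dualSelmer`
(cotorsion of `coker φ_𝓛` from CRK: `Specification.isCotorsion_coker_phi_of_crk`), `hC6 :=
sur_of_dualSelmer_eq_zero`, and THE canonical invariant maps' level law / perfectness / sum formula /
unramified orthogonality. [cite: Greenberg2010, Prop. 3.2.1 (c) and proof (p. 15 L19–32)]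
[cite: Greenberg2016Selmer, Prop. 2.6.3 (c) (§2.6 p. 10 L13–22)] [cite: MilneADT2006, Ch. I, Thm. 4.10 (b), Thm. 2.6] -/
theorem sur_of_crk_caseC_tc_of_dualSha_torsion [IsTotallyComplex K] (hS : S.Finite)
    (hSp : ∀ v : HeightOneSpectrum (𝓞 K), ((p : ℕ) : 𝓞 K) ∈ v.asIdeal → v ∈ S)
    (e : Λ ≃+* MvPowerSeries (Fin m) ℤ_[p]) (hD : IsCofinitelyGenerated Λ D) (L : Specification S ρ)
    (hdiv : IsDivisible Λ D) (hCRK : L.CRK) {η : HeightOneSpectrum (𝓞 K)} (hηS : η ∈ S)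
    (hLOC1 : LOC1 S ρ (Sum.inr η)) (hQ : IsDivisible Λ (L.Q (Sum.inr η)))
    (hSha : ∀ y ∈ dualSha ρ e hD (fun k => LocalInvariants.canonical K (p ^ k)), ∃ r : Λ, r ≠ 0 ∧
      cohomologyMap (scalarDualEndHom ρ e hD r) 1 y = 0) :
    L.SUR := by
  haveI := finite_sigmaPlace' (K := K) hS
  -- `Σ` as a Finset of places
  obtain ⟨Sig, hSig⟩ : ∃ T : Finset (Place K), ∀ v : Place K, v ∈ T ↔ InSigma S v := by
    haveI : Fintype (SigmaPlace S) := Fintype.ofFinite _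
    refine ⟨Finset.univ.image fun v : SigmaPlace S => (v.1 : Place K), fun v => ?_⟩
    simp only [Finset.mem_image, Finset.mem_univ, true_and]
    exact ⟨fun ⟨u, hu⟩ => hu ▸ u.2, fun h => ⟨⟨v, h⟩, rfl⟩⟩
  -- `coker(φ_𝓛)` is cotorsion (CRK + cofinite generation; `Λ` is a domain)
  haveI : IsDomain Λ :=
    haveI : IsDomain (MvPowerSeries (Fin m) ℤ_[p]) := NoZeroDivisors.to_isDomain _
    MulEquiv.isDomain _ e.toMulEquiv
  have hcot : IsCotorsion Λ (L.QGlobal ⧸ LinearMap.range L.phi) :=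
    Specification.isCotorsion_coker_phi_of_crk L (isCofinitelyGenerated_H_one S ρ e hD hS)
      (isCofinitelyGenerated_QGlobal ρ hS e hD L) hCRK
  exact Specification.sur_of_dualSelmer_inputs ρ e hD hdiv hηS hLOC1 hQ
    (invLevelLaw_canonical (K := K) (p := p) (Sum.inr η : Place K))
    (fun k => LocalInvariants.canonical_isPerfect)
    (fun y hy => exists_ne_zero_scalar_mem_dualSha_of_mem_dualSelmer ρ e hD Sig hSig hSp
      (fun v => invLevelLaw_canonical (K := K) (p := p) v) (fun k => LocalInvariants.canonical_isPerfect)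
      (fun k => sumLocalTermEqZero_canonical (K := K) (p ^ k))
      (fun k => unramifiedOrthogonal_of_isPerfect_allLevels _ LocalInvariants.canonical_isPerfect)
      hcot hy)
    hSha (sur_of_dualSelmer_eq_zero ρ L e hD hSp)

/-- **The road's END STATEMENT modulo (γ)**: `Greenberg2016.prop263_sur_of_crk_caseC_tc` (Greenberg 2016
Prop. 2.6.3 (c) = Greenberg 2010 Prop. 3.2.1 (c), `K` totally complex, its binders verbatim) follows from
«for every such `p, K, Σ, Λ ≅ ℤ_p⟦T₁,…,T_m⟧` and every cofinitely generated divisible `𝐃` with LEO(𝐃),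
`Ш¹(K, Σ, T*)` (canonical invariant maps, layers `𝐃[𝔪ᵏ]`) is `Λ`-torsion» — Greenberg's step (γ), the
one input not yet in the tree by name.  (`𝐃` cofree over `R ⊇ Λ` finite ⇒ cofinitely generated over `Λ`.)
[cite: Greenberg2010, Prop. 3.2.1 (c) and proof (p. 15 L19–32)] [cite: Greenberg2016Selmer, Prop. 2.6.3 (c) (§2.6 p. 10 L13–22)] -/
theorem prop263_sur_of_crk_caseC_tc_of_dualSha_torsion
    (hSha : ∀ (p : ℕ) [Fact p.Prime] (K : Type) [Field K] [NumberField K] [IsTotallyComplex K]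
        (S : Set (HeightOneSpectrum (𝓞 K))), S.Finite →
        (∀ v : HeightOneSpectrum (𝓞 K), ((p : ℕ) : 𝓞 K) ∈ v.asIdeal → v ∈ S) →
      ∀ (Λ : Type) [CommRing Λ] [IsLocalRing Λ] [TopologicalSpace Λ] [IsTopologicalRing Λ] (m : ℕ)
        (e : Λ ≃+* MvPowerSeries (Fin m) ℤ_[p])
        (D : Type) [AddCommGroup D] [Module Λ D] [TopologicalSpace D] [DiscreteTopology D]
        [ContinuousSMul Λ D] (ρ : ContinuousRep (GaloisGroupUnramifiedOutside K S) Λ D)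
        (hD : IsCofinitelyGenerated Λ D), IsDivisible Λ D → LEO S ρ →
      ∀ y ∈ dualSha ρ e hD (fun k => LocalInvariants.canonical K (p ^ k)), ∃ r : Λ, r ≠ 0 ∧
        cohomologyMap (scalarDualEndHom ρ e hD r) 1 y = 0) :
    prop263_sur_of_crk_caseC_tc := by
  intro p _ K _ _ _ S hS hSp Λ _ _ _ _ m hΛ R _ _ _ _ hinj hfin hcpl hres hchar D _ _ _ _ _ _ _ _ ρ hR hT
    hpD L hL hdiv hLEO hCRK hc
  obtain ⟨e⟩ := hΛ
  obtain ⟨η, hηS, hLOC1, hQ⟩ := hc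
  -- `𝐃` is cofinitely generated over `Λ` (cofree over `R`, `R` finite over `Λ`)
  haveI : IsScalarTower Λ R (CharacterModule D) := ⟨fun a r c ↦ by
    ext d
    simp only [CharacterModule.smul_apply, smul_assoc, smul_comm r a d]⟩
  haveI : Module.Finite Λ R := hfin
  haveI : Module.Finite R (CharacterModule D) :=
    (hT _ (AddMonoidHom.id (CharacterModule D)) (isDualPairing_characterModule R D)).2
  have hD : IsCofinitelyGenerated Λ D :=
    isCofinitelyGenerated_iff_module_finite_characterModule.2 (Module.Finite.trans R _)
  exact sur_of_crk_caseC_tc_of_dualSha_torsion ρ hS hSp e hD L hdiv hCRK hηS hLOC1 hQ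
    (hSha p K S hS hSp Λ m e D ρ hD hdiv hLEO)

end Summit.BirchSwinnertonDyer.BirchSwinnertonDyer.Theorems.SurLambda

end
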